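import Summits.MatrixMultiplication.OmegaCensus.STPPVosperSlackOneA2CoverRowsZ59N
import Summits.MatrixMultiplication.OmegaCensus.STPPVosperSlackOneBCoverRowsZ59
import Summits.MatrixMultiplication.OmegaCensus.STPPVosperSlackOneLawA2CoverSpecB
import Summits.MatrixMultiplication.OmegaCensus.STPP222SqSymmetry
import Summits.MatrixMultiplication.OmegaCensus.STPPVosperClash225Tools

/-!
# ω-census (abelian STPP census): `{(2,3,3),(2,3,4),(3,3,2)}` has no STPP family in `ℤ₅₉` — slack-1 law, exact-cover stage in case β closed by the RUN LAW (kernel, UNCONDITIONAL)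

HONEST FRAMING (pub-omega census; verbatim): lottery ticket; floor = certified bounds/negative ranges.
Census STRUCTURE (seat pub-omega-stpp-1 gen 31, 2026-08-28), family (b2).  The pattern `{(2,3,3),(2,3,4),(3,3,2)}` at order `59` was kernel-open:
in the reading `(a,b,c) = (2,4,3)` at the `(2,3,4)` block of the family `(−A, −C, −B)` (`isSTPP_negSwap`) the slack-1 chain is
`z + b + vol + a + L = 15 + 4 + 24 + 2 + 15 = 60 = p + 1` (`m = 16`, `n = 40`); the tight-type table (case γ) and the case-α₂ cover table are clean
(`a2CoverRowN_59_233234332_all`: no duplicate-free configuration survives the prefix law), but the case-β (Hamidoune–Rødseth) table has survivors: ratios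
`±2⁻¹ = 29, 30`, hole `hh ∈ {8, 12, …, 32}`, `g₀ = 3`.  They die at the exact-cover stage WITHOUT search, by the RUN LAW (`STPPVosperCoverRuns.lean`):
`Z° = {0, 45, …, 58}` is the cyclic window `[45, 45 + 15)`, `Y°` (values `29 k` resp. `30 k`, `k < 15`) splits into two runs of `8` and `7` points at
cyclic distance `23 ≥ 15`, every translate `C_k − x` of another block lies in one run, and `8 ∉ {3 m₁ + 3 m₂}` (`bCoverRowR_59_233234332_all`,
certificates `(45, 15, [(52, 8), (23, 7)])`, `(45, 15, [(0, 8), (30, 7)])`).  This file assembles the rows and the tight-type table and applies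
`no_isSTPP_of_slack_one_tables_prime_a2_coverSpecB`.  UNCONDITIONAL (the Hamidoune–Rødseth input of case β is the tree theorem
`hamidouneRodsethInverseTheorem_holds`).  Cross-checked in python by two code-disjoint mirrors (stpp-1 g31 `pilot_beta_233_234_332.py`, stpp-2 g25
`cover.py`): no exact cover in this reading.  Nothing here is progress on `ω`.

References: Y. O. Hamidoune, Ø. J. Rødseth, Acta Arith. 92 (2000) 251–262; A. G. Vosper, J. London Math. Soc. 31 (1956); M. B. Nathanson, GTM 165,
Thm 2.7; H. Cohn, R. Kleinberg, B. Szegedy, C. Umans, FOCS 2005 (arXiv:math/0511460), Def. 5.1.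
-/

open Finset
open scoped Pointwise

namespace Summit.MatrixMultiplication.OmegaCensus.CubeNB

open Literature.Computability.AlgebraicComplexity
open Literature.Combinatorics.Additive
open Summit.MatrixMultiplication.OmegaCensus.STPPKneser

/-! ## Target and tight-type table -/

section Tables

/-- The target at `59` for `(a, b) = (2, 4)`: every element is `0` or `±k` with `k < 4` (the `±k⁻¹`, `k < 2`, part is `±1`). [folklore] -/
theorem target_59_a2_b4 : ∀ jv ∈ ({0, 1, 58, 2, 57, 3, 56} : Finset ℕ),
    jv = 0 ∨ (∃ k ∈ range 4, 1 ≤ k ∧ (jv = k ∨ jv + k = 59)) ∨ (∃ k ∈ range 2, 1 ≤ k ∧ (jv * k % 59 = 1 ∨ jv * k % 59 = 59 - 1)) := by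
  decide

/-- Tight-type table `(n, m, r) = (40, 16, 4)` at `59` with target `{0, ±1, ±2, ±3}`. [folklore] -/
theorem table_40_16_4_a2b4 : ∀ j < 59, ∀ t < 59, (∀ i < 16, (t + j * i) % 59 < 40) →
    (∀ k < 16, 4 ∣ (t + j * k) % 59 - #((range 16).filter fun i => (t + j * i) % 59 < (t + j * k) % 59)) →
    j ∈ ({0, 1, 58, 2, 57, 3, 56} : Finset ℕ) := by
  decide +kernel

end Tables

/-! ## The kill -/

section Kills

/-- **`{(2,3,3),(2,3,4),(3,3,2)}` has no STPP family in `ℤ₅₉`** — UNCONDITIONAL (slack-1 `a = 2` law for the family `(−A, −C, −B)` at block `1`, reading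
`(a,b,c) = (2,4,3)`, `(z, b, vol, a, L) = (15, 4, 24, 2, 15)`, `(m, n) = (16, 40)`; case γ by the tight-type table, case α₂ by the cover-table rows
`a2CoverRowN_59_233234332_all`, case β by the run-certificate rows `bCoverRowR_59_233234332_all`).  OMEGA-TABLE leaf (ℤ₅₉ kernel census).
[cite: CohnKleinbergSzegedyUmans2005, Def. 5.1] [cite: Vosper1956, main theorem; Nathanson1996, Thm 2.7]
[cite: HamidouneRodseth2000, main theorem (§1, p. 252)] -/
theorem no_isSTPP_zmod59_233_234_332_kernel (A B C : Fin 3 → Finset (ZMod 59)) (hS : IsSTPP A B C)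
    (hA : ∀ i, #(A i) = ![2, 2, 3] i) (hB : ∀ i, #(B i) = ![3, 3, 3] i) (hC : ∀ i, #(C i) = ![3, 4, 2] i) : False := by
  haveI : Fact (Nat.Prime 59) := ⟨prime_59⟩
  have hAne : ∀ i, (A i).Nonempty := fun i => card_pos.1 (by rw [hA]; fin_cases i <;> simp)
  have hBne : ∀ i, (B i).Nonempty := fun i => card_pos.1 (by rw [hB]; fin_cases i <;> simp)
  have hCne : ∀ i, (C i).Nonempty := fun i => card_pos.1 (by rw [hC]; fin_cases i <;> simp)
  -- the family (−A, −C, −B)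
  set A' : Fin 3 → Finset (ZMod 59) := fun t => (A t).image Neg.neg with hA'
  set B' : Fin 3 → Finset (ZMod 59) := fun t => (C t).image Neg.neg with hB'
  set C' : Fin 3 → Finset (ZMod 59) := fun t => (B t).image Neg.neg with hC'
  have hS' : IsSTPP A' B' C' := STPP222SqNeg.isSTPP_negSwap hS
  have hcA' : ∀ t, #(A' t) = #(A t) := fun t => Finset.card_image_of_injective _ neg_injective
  have hcB' : ∀ t, #(B' t) = #(C t) := fun t => Finset.card_image_of_injective _ neg_injective
  have hcC' : ∀ t, #(C' t) = #(B t) := fun t => Finset.card_image_of_injective _ neg_injective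
  have hAne' : ∀ t, (A' t).Nonempty := fun t => (hAne t).image _
  have hBne' : ∀ t, (B' t).Nonempty := fun t => (hCne t).image _
  have hCne' : ∀ t, (C' t).Nonempty := fun t => (hBne t).image _
  have e1 : (univ : Finset (Fin 3)).erase 1 = {0, 2} := by decide
  have hz : ∑ k ∈ (univ : Finset (Fin 3)).erase 1, #(A' k) * #(C' k) = 15 := by
    rw [e1, Finset.sum_pair (by decide)]; simp [hcA', hcC', hA, hB]
  have hL : ∑ k ∈ (univ : Finset (Fin 3)).erase 1, #(B' k) * #(C' k) = 15 := by
    rw [e1, Finset.sum_pair (by decide)]; simp [hcB', hcC', hC, hB]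
  have ha : #(A' 1) = 2 := by rw [hcA', hA]; simp
  have hb : #(B' 1) = 4 := by rw [hcB', hC]; simp
  have hvol : #(A' 1) * #(B' 1) * #(C' 1) = 24 := by rw [hcA', hcB', hcC', hA, hB, hC]; simp
  have hsz : (([0, 2] : List (Fin 3)).map fun k => (#(A' k), #(B' k), #(C' k))) = [(2, 3, 3), (3, 2, 3)] := by
    simp [hcA', hcB', hcC', hA, hB, hC]
  exact no_isSTPP_of_slack_one_tables_prime_a2_coverSpecB A' B' C' hS' hAne' hBne' hCne' 1 ⟨0, by decide⟩ [0, 2] (by decide)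
    (fun k => by fin_cases k <;> decide) ha hb hvol hz hL rfl (by norm_num) (by norm_num) (by norm_num) (by norm_num) (m := 16) (n := 40) rfl rfl
    target_59_a2_b4 table_40_16_4_a2b4
    (fun j hj ℓ₁ h1 h2 t₁ ht₁ t₂ ht₂ hw1 hw2 hnd hpre => by
      rw [hsz]; exact a2CoverRowN_spec (a2CoverRowN_59_233234332_all j hj) ℓ₁ h1 h2 t₁ ht₁ t₂ ht₂ hw1 hw2 hnd hpre)
    (fun j hj t ht hwin hh hhh hhole g₀ hg₀ htile => by
      rw [hsz]; exact bCoverRowR_spec (bCoverRowR_59_233234332_all j hj) t ht hwin hh hhh hhole g₀ hg₀ htile)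

end Kills

end Summit.MatrixMultiplication.OmegaCensus.CubeNB
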